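import Literature.MathematicalPhysics.QuantumLattice.SectorSymbolLineBounds
import Literature.MathematicalPhysics.QuantumLattice.TorusSectorPropagatorConstants
import Mathlib.Analysis.SpecialFunctions.Trigonometric.Deriv
import HarnessLib

/-!
# Line derivatives of the denominator `D = -ik₀ + ε(k⃗) - μ`: all orders, and the anisotropic first derivative on a sector

Topic `MathematicalPhysics/QuantumLattice`; input of the product-symbol estimates of Benfatto–Giuliani–Mastropietro
2006, §2.7 (the sector cutoffs `F_{h,ω}χ = σ·D` are the single-scale sector symbol `σ` times the denominator, so their
line-derivative bounds follow from those of `σ` (`SectorSymbolLineBounds.lean`) and of `D` by Leibniz,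
`Analysis/Calculus/IteratedDerivLeibnizBound.lean`).  Along a line `s ↦ (k₀, k⃗) + s(w₀, w⃗)`:

* `abs_iteratedDeriv_cos_affine_le` — `|∂ₛⁱ cos(a + s b)| ≤ |b|ⁱ`;
* **`abs_iteratedDeriv_lineDispersion_le`** — `|∂ₛⁱ (ε(k⃗ + s w⃗) - μ)| ≤ 2|w₁|ⁱ + 2|w₂|ⁱ` for `i ≥ 1`, and
  `deriv_lineDispersion` — the first derivative is `⟨∇ε, w⃗⟩ = Σⱼ 2 sin(kⱼ + s wⱼ) wⱼ`;
* **`norm_iteratedDeriv_sectorDenom_line_le`** — `‖∂ₛⁱ D‖ ≤ 2|w₁|ⁱ + 2|w₂|ⁱ` for `i ≥ 2` (the linear time part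
  drops out), and `norm_deriv_sectorDenom_line_le` — `‖∂ₛ D‖ ≤ |w₀| + |⟨∇ε(k⃗ + s w⃗), w⃗⟩|`;
* `frame_decomposition_fst/_snd` — `w⃗ = ⟨w⃗, n⟩ n + ⟨w⃗, τ⟩ τ` for the Fermi frame, and
  **`exists_abs_grad_dot_le_on_sector`** — ON THE SUPPORT of the sector cutoff `F_{h,ω}` (`|k⃗| ≤ π/2`) the gradient
  pairs anisotropically: `|⟨∇ε(k⃗), w⃗⟩| ≤ 4|⟨w⃗, n⟩| + c 2^{-n} |⟨w⃗, τ⟩|` with ONE constant `c = c(μ, e₀)` for all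
  scales and sectors (`AnisotropicSectorSupport.abs_grad_dot_fermiTangent_le_of_ne_zero`: the tangential gradient is
  `O(γ^{h/2})` on the sector), hence `≤ 4^{-n}(4 + c)(4ⁿ|⟨w⃗,n⟩| + 2ⁿ|⟨w⃗,τ⟩|)`: the first derivative of `D` costs `γ^h`
  times the direction cost, like `D` itself (`‖D‖ < e₀γ^h` on the support, `norm_sectorDenom_lt_of_ne_zero`).

Everything is proved; no definitions (the dispersion along a line is written out), no named facts.

## Sources

G. Benfatto, A. Giuliani, V. Mastropietro, Ann. Henri Poincaré 7 (2006) 809–898, §2.5 (2.53)–(2.54), §2.7 (2.66)–(2.71a)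
(`BenfattoGiulianiMastropietro2006`).
-/

noncomputable section

open Set
open scoped Real

namespace Literature.MathematicalPhysics.QuantumLattice

/-! ### Cosines along a line -/

/-- **`|∂ₛⁱ cos(a + s b)| ≤ |b|ⁱ`.** [folklore] -/
theorem abs_iteratedDeriv_cos_affine_le (a b s : ℝ) (i : ℕ) :
    |iteratedDeriv i (fun s : ℝ => Real.cos (a + s * b)) s| ≤ |b| ^ i := by
  have hfun : (fun s : ℝ => Real.cos (a + s * b)) = fun s : ℝ => (fun z : ℝ => Real.cos (z + a)) (b * s) := by
    funext s; simp only; ring_nf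
  have hcd : ContDiff ℝ i fun z : ℝ => Real.cos (z + a) := Real.contDiff_cos.comp (contDiff_id.add contDiff_const)
  rw [hfun, iteratedDeriv_comp_const_mul hcd b]
  simp only
  rw [iteratedDeriv_comp_add_const, abs_mul, abs_pow]
  exact mul_le_of_le_one_right (pow_nonneg (abs_nonneg _) _) (Real.abs_iteratedDeriv_cos_le_one i _)

/-- `∂ₛ cos(a + s b) = -sin(a + s b) · b`. [folklore] -/
theorem hasDerivAt_cos_affine (a b s : ℝ) :
    HasDerivAt (fun s : ℝ => Real.cos (a + s * b)) (-Real.sin (a + s * b) * b) s := by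
  have h : HasDerivAt (fun s : ℝ => a + s * b) b s := by
    simpa using (hasDerivAt_id s).mul_const b |>.const_add a
  exact (Real.hasDerivAt_cos _).comp s h

/-! ### The dispersion along a line -/

/-- The dispersion along a line, written out: `ε(k⃗ + s w⃗) - μ = -2 cos(k₁ + s w₁) - 2 cos(k₂ + s w₂) - μ`. [folklore] -/
theorem sqDispersion_add_smul_sub (μ : ℝ) (k w : Fin 2 → ℝ) (s : ℝ) :
    sqDispersion (k + s • w) - μ = -2 * Real.cos (k 0 + s * w 0) + -2 * Real.cos (k 1 + s * w 1) + -μ := by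
  simp only [sqDispersion, Pi.add_apply, Pi.smul_apply, smul_eq_mul]
  ring

/-- **All derivatives of the dispersion along a line**: for `i ≥ 1`,
`|∂ₛⁱ (s ↦ -2 cos(k₁ + s w₁) - 2 cos(k₂ + s w₂) - μ)| ≤ 2|w₁|ⁱ + 2|w₂|ⁱ`. [folklore] -/
theorem abs_iteratedDeriv_lineDispersion_le (μ : ℝ) (k w : Fin 2 → ℝ) (s : ℝ) {i : ℕ} (hi : 1 ≤ i) :
    |iteratedDeriv i (fun s : ℝ => -2 * Real.cos (k 0 + s * w 0) + -2 * Real.cos (k 1 + s * w 1) + -μ) s| ≤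
      2 * |w 0| ^ i + 2 * |w 1| ^ i := by
  have h0 : ContDiff ℝ i fun s : ℝ => Real.cos (k 0 + s * w 0) := by fun_prop
  have h1 : ContDiff ℝ i fun s : ℝ => Real.cos (k 1 + s * w 1) := by fun_prop
  have h0' : ContDiff ℝ i fun s : ℝ => -2 * Real.cos (k 0 + s * w 0) := by fun_prop
  have h1' : ContDiff ℝ i fun s : ℝ => -2 * Real.cos (k 1 + s * w 1) := by fun_prop
  have hsum : (fun s : ℝ => -2 * Real.cos (k 0 + s * w 0) + -2 * Real.cos (k 1 + s * w 1) + -μ) =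
      fun s : ℝ => -μ + (-2 * Real.cos (k 0 + s * w 0) + -2 * Real.cos (k 1 + s * w 1)) := by
    funext s; ring
  rw [hsum, iteratedDeriv_const_add hi, iteratedDeriv_fun_add h0'.contDiffAt h1'.contDiffAt,
    iteratedDeriv_const_mul (-2 : ℝ) h0.contDiffAt, iteratedDeriv_const_mul (-2 : ℝ) h1.contDiffAt]
  calc |(-2) * iteratedDeriv i (fun s : ℝ => Real.cos (k 0 + s * w 0)) s +
        (-2) * iteratedDeriv i (fun s : ℝ => Real.cos (k 1 + s * w 1)) s|
      ≤ |(-2) * iteratedDeriv i (fun s : ℝ => Real.cos (k 0 + s * w 0)) s| +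
          |(-2) * iteratedDeriv i (fun s : ℝ => Real.cos (k 1 + s * w 1)) s| := abs_add_le _ _
    _ = 2 * |iteratedDeriv i (fun s : ℝ => Real.cos (k 0 + s * w 0)) s| +
          2 * |iteratedDeriv i (fun s : ℝ => Real.cos (k 1 + s * w 1)) s| := by
        rw [abs_mul, abs_mul, abs_neg, abs_two]
    _ ≤ 2 * |w 0| ^ i + 2 * |w 1| ^ i :=
        add_le_add (mul_le_mul_of_nonneg_left (abs_iteratedDeriv_cos_affine_le _ _ _ _) zero_le_two)
          (mul_le_mul_of_nonneg_left (abs_iteratedDeriv_cos_affine_le _ _ _ _) zero_le_two)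

/-- **The first derivative of the dispersion along a line is the gradient pairing**:
`∂ₛ (ε(k⃗ + s w⃗) - μ) = 2 sin(k₁ + s w₁) w₁ + 2 sin(k₂ + s w₂) w₂ = ⟨∇ε(k⃗ + s w⃗), w⃗⟩`. [folklore] -/
theorem hasDerivAt_lineDispersion (μ : ℝ) (k w : Fin 2 → ℝ) (s : ℝ) :
    HasDerivAt (fun s : ℝ => -2 * Real.cos (k 0 + s * w 0) + -2 * Real.cos (k 1 + s * w 1) + -μ)
      (2 * Real.sin (k 0 + s * w 0) * w 0 + 2 * Real.sin (k 1 + s * w 1) * w 1) s := by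
  have h := (((hasDerivAt_cos_affine (k 0) (w 0) s).const_mul (-2)).add
    ((hasDerivAt_cos_affine (k 1) (w 1) s).const_mul (-2))).add_const (-μ)
  refine h.congr_deriv ?_
  ring

/-! ### The denominator along a line -/

/-- The denominator along a line, split into the linear time part and the real dispersion part. [folklore] -/
theorem sectorDenom_line_eq (μ : ℝ) (q w : ℝ × (Fin 2 → ℝ)) (s : ℝ) :
    sectorDenom μ (q + s • w) =
      (-(Complex.I * (q.1 : ℂ)) + s • (-(Complex.I * (w.1 : ℂ)))) +
        Complex.ofRealCLM (-2 * Real.cos (q.2 0 + s * w.2 0) + -2 * Real.cos (q.2 1 + s * w.2 1) + -μ) := by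
  rw [← sqDispersion_add_smul_sub, Complex.ofRealCLM_apply, sectorDenom, Prod.fst_add, Prod.snd_add, Prod.smul_fst,
    Prod.smul_snd, Complex.real_smul, smul_eq_mul]
  push_cast
  ring

/-- Iterated derivatives commute with the real embedding: `‖∂ₛⁱ (ofReal ∘ r)‖ = |∂ₛⁱ r|`. [folklore] -/
theorem norm_iteratedDeriv_ofReal_comp {r : ℝ → ℝ} {i : ℕ} (hr : ContDiff ℝ i r) (s : ℝ) :
    ‖iteratedDeriv i (fun s => Complex.ofRealCLM (r s)) s‖ = |iteratedDeriv i r s| := by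
  have h := LinearIsometry.norm_iteratedFDeriv_comp_left (𝕜 := ℝ) Complex.ofRealLI hr.contDiffAt (i := i) le_rfl (x := s)
  rw [norm_iteratedFDeriv_eq_norm_iteratedDeriv, norm_iteratedFDeriv_eq_norm_iteratedDeriv, Real.norm_eq_abs] at h
  have hfun : (fun s => Complex.ofRealCLM (r s)) = Complex.ofRealLI ∘ r := rfl
  rw [hfun]
  exact h

/-- The linear time part has no derivatives of order `≥ 2`. [folklore] -/
theorem iteratedDeriv_affine_eq_zero (c v : ℂ) {i : ℕ} (hi : 2 ≤ i) (s : ℝ) :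
    iteratedDeriv i (fun s : ℝ => c + s • v) s = 0 := by
  have h1 : iteratedDeriv i (fun s : ℝ => c + s • v) s = iteratedDeriv i (fun s : ℝ => s • v) s :=
    iteratedDeriv_const_add (by omega) c
  rw [h1, iteratedDeriv_smul_const (contDiff_id.contDiffAt (n := i)) v]
  have : iteratedDeriv i (fun s : ℝ => s) s = 0 := by
    rw [show (fun s : ℝ => s) = id from rfl, iteratedDeriv_id]
    rw [if_neg (by omega), if_neg (by omega)]
  rw [this, zero_smul]

/-- **Higher line derivatives of the denominator**: `‖∂ₛⁱ D((k₀,k⃗) + s(w₀,w⃗))‖ ≤ 2|w₁|ⁱ + 2|w₂|ⁱ` for `i ≥ 2`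
(everywhere: `ε` is a trigonometric polynomial and the time part is linear). [cite: BenfattoGiulianiMastropietro2006, §2.7 (2.71a)] -/
theorem norm_iteratedDeriv_sectorDenom_line_le (μ : ℝ) (q w : ℝ × (Fin 2 → ℝ)) (s : ℝ) {i : ℕ} (hi : 2 ≤ i) :
    ‖iteratedDeriv i (fun s : ℝ => sectorDenom μ (q + s • w)) s‖ ≤ 2 * |w.2 0| ^ i + 2 * |w.2 1| ^ i := by
  have hr : ContDiff ℝ i fun s : ℝ => -2 * Real.cos (q.2 0 + s * w.2 0) + -2 * Real.cos (q.2 1 + s * w.2 1) + -μ := by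
    fun_prop
  have hlin : ContDiff ℝ i fun s : ℝ => -(Complex.I * (q.1 : ℂ)) + s • (-(Complex.I * (w.1 : ℂ))) := by fun_prop
  have hcomp : ContDiff ℝ i fun s : ℝ =>
      Complex.ofRealCLM (-2 * Real.cos (q.2 0 + s * w.2 0) + -2 * Real.cos (q.2 1 + s * w.2 1) + -μ) :=
    Complex.ofRealCLM.contDiff.comp hr
  have hfun : (fun s : ℝ => sectorDenom μ (q + s • w)) = fun s : ℝ =>
      (-(Complex.I * (q.1 : ℂ)) + s • (-(Complex.I * (w.1 : ℂ)))) +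
        Complex.ofRealCLM (-2 * Real.cos (q.2 0 + s * w.2 0) + -2 * Real.cos (q.2 1 + s * w.2 1) + -μ) :=
    funext fun s => sectorDenom_line_eq μ q w s
  rw [hfun, iteratedDeriv_fun_add hlin.contDiffAt hcomp.contDiffAt, iteratedDeriv_affine_eq_zero _ _ hi, zero_add,
    norm_iteratedDeriv_ofReal_comp hr]
  exact abs_iteratedDeriv_lineDispersion_le μ q.2 w.2 s (by omega)

/-- **The first line derivative of the denominator**: `‖∂ₛ D((k₀,k⃗) + s(w₀,w⃗))‖ ≤ |w₀| + |⟨∇ε(k⃗ + s w⃗), w⃗⟩|`.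
[cite: BenfattoGiulianiMastropietro2006, §2.5 (2.53)] -/
theorem norm_deriv_sectorDenom_line_le (μ : ℝ) (q w : ℝ × (Fin 2 → ℝ)) (s : ℝ) :
    ‖iteratedDeriv 1 (fun s : ℝ => sectorDenom μ (q + s • w)) s‖ ≤
      |w.1| + |2 * Real.sin (q.2 0 + s * w.2 0) * w.2 0 + 2 * Real.sin (q.2 1 + s * w.2 1) * w.2 1| := by
  have hfun : (fun s : ℝ => sectorDenom μ (q + s • w)) = fun s : ℝ =>
      (-(Complex.I * (q.1 : ℂ)) + s • (-(Complex.I * (w.1 : ℂ)))) +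
        Complex.ofRealCLM (-2 * Real.cos (q.2 0 + s * w.2 0) + -2 * Real.cos (q.2 1 + s * w.2 1) + -μ) :=
    funext fun s => sectorDenom_line_eq μ q w s
  have hd : HasDerivAt (fun s : ℝ => sectorDenom μ (q + s • w))
      (-(Complex.I * (w.1 : ℂ)) + Complex.ofRealCLM (2 * Real.sin (q.2 0 + s * w.2 0) * w.2 0 +
        2 * Real.sin (q.2 1 + s * w.2 1) * w.2 1)) s := by
    rw [hfun]
    have hlin : HasDerivAt (fun s : ℝ => -(Complex.I * (q.1 : ℂ)) + s • (-(Complex.I * (w.1 : ℂ))))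
        (-(Complex.I * (w.1 : ℂ))) s := by
      simpa using ((hasDerivAt_id s).smul_const (-(Complex.I * (w.1 : ℂ)))).const_add (-(Complex.I * (q.1 : ℂ)))
    have hre := (hasDerivAt_lineDispersion μ q.2 w.2 s)
    have hcomp : HasDerivAt (fun s : ℝ => Complex.ofRealCLM (-2 * Real.cos (q.2 0 + s * w.2 0) +
        -2 * Real.cos (q.2 1 + s * w.2 1) + -μ))
        (Complex.ofRealCLM (2 * Real.sin (q.2 0 + s * w.2 0) * w.2 0 + 2 * Real.sin (q.2 1 + s * w.2 1) * w.2 1)) s :=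
      Complex.ofRealCLM.hasFDerivAt.comp_hasDerivAt s hre
    exact hlin.add hcomp
  rw [iteratedDeriv_one, hd.deriv]
  refine (norm_add_le _ _).trans (add_le_add (le_of_eq ?_) (le_of_eq ?_))
  · rw [norm_neg, norm_mul, Complex.norm_I, one_mul, Complex.norm_real, Real.norm_eq_abs]
  · rw [Complex.ofRealCLM_apply, Complex.norm_real, Real.norm_eq_abs]

/-! ### The anisotropic first derivative on a sector -/

section Sector

variable {μ : ℝ} (hμ₁ : -4 < μ) (hμ₂ : μ < -2 - Real.sqrt 2)
include hμ₁ hμ₂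

/-- **Frame decomposition**, first component: `w₁ = ⟨w⃗, n⟩ n₁ + ⟨w⃗, τ⟩ τ₁`. [folklore] -/
theorem frame_decomposition_fst (θ₀ : ℝ) (w : Fin 2 → ℝ) :
    w 0 = (w 0 * fermiNormal μ θ₀ 0 + w 1 * fermiNormal μ θ₀ 1) * fermiNormal μ θ₀ 0 +
      (w 0 * fermiTangent μ θ₀ 0 + w 1 * fermiTangent μ θ₀ 1) * fermiTangent μ θ₀ 0 := by
  obtain ⟨h0, -, h01⟩ := fermiFrame_complete hμ₁ hμ₂ θ₀
  linear_combination (-(w 0)) * h0 - w 1 * h01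

/-- **Frame decomposition**, second component: `w₂ = ⟨w⃗, n⟩ n₂ + ⟨w⃗, τ⟩ τ₂`. [folklore] -/
theorem frame_decomposition_snd (θ₀ : ℝ) (w : Fin 2 → ℝ) :
    w 1 = (w 0 * fermiNormal μ θ₀ 0 + w 1 * fermiNormal μ θ₀ 1) * fermiNormal μ θ₀ 1 +
      (w 0 * fermiTangent μ θ₀ 0 + w 1 * fermiTangent μ θ₀ 1) * fermiTangent μ θ₀ 1 := by
  obtain ⟨-, h1, h01⟩ := fermiFrame_complete hμ₁ hμ₂ θ₀
  linear_combination (-(w 1)) * h1 - w 0 * h01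

/-- **The gradient pairs anisotropically on a sector**: for `0 < e₀ ≤ (4+μ)/2` there is `c` such that for ALL scales `n`,
sectors `ω`, momenta `k⃗` with `F_{h,ω}(k₀, k⃗) ≠ 0`, `|k⃗| ≤ π/2`, and all `w⃗`,
`|⟨∇ε(k⃗), w⃗⟩| ≤ 4|⟨w⃗, n(θ_{n,ω})⟩| + c 2^{-n} |⟨w⃗, τ(θ_{n,ω})⟩|`. [cite: BenfattoGiulianiMastropietro2006, §2.5 (2.53)–(2.54)] -/
theorem exists_abs_grad_dot_le_on_sector {e₀ : ℝ} (he : 0 < e₀) (he' : e₀ ≤ (4 + μ) / 2) :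
    ∃ c : ℝ, 0 ≤ c ∧ ∀ {n : ℕ} {ω : ℤ} {k₀ : ℝ} {k : Fin 2 → ℝ}, ‖momToComplex k‖ ≤ π / 2 →
      anisotropicCutoff e₀ μ n ω (k₀, k) ≠ 0 → ∀ w : Fin 2 → ℝ,
        |2 * Real.sin (k 0) * w 0 + 2 * Real.sin (k 1) * w 1| ≤
          4 * |w 0 * fermiNormal μ (((ω : ℝ) + 1 / 2) * sectorWidth n) 0 + w 1 * fermiNormal μ (((ω : ℝ) + 1 / 2) * sectorWidth n) 1| +
            c * (2 : ℝ) ^ (-(n : ℤ)) *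
              |w 0 * fermiTangent μ (((ω : ℝ) + 1 / 2) * sectorWidth n) 0 + w 1 * fermiTangent μ (((ω : ℝ) + 1 / 2) * sectorWidth n) 1| := by
  obtain ⟨a₂, ha₂, hbound⟩ := abs_grad_dot_fermiTangent_le_of_ne_zero hμ₁ hμ₂ he he'
  -- the tangential constant: `2√K a₂ (3w_n/4) + 4C_r e₀4^{-n} ≤ c 2^{-n}` with
  -- `c = 2√K a₂ (3π/4) + 4 C_r e₀` (`w_n = π2^{-n}`, `4^{-n} ≤ 2^{-n}`)
  set K : ℝ := Real.sqrt (π ^ 2 / 8 + (4 * π ^ 3 / (μ + 4)) ^ 2) with hK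
  set Cr : ℝ := π / (4 * Real.sqrt ((4 + μ) / 2)) with hCr
  have h4 : 0 < 4 + μ := by linarith
  have hK0 : 0 ≤ K := Real.sqrt_nonneg _
  have hCr0 : 0 ≤ Cr := by rw [hCr]; positivity
  refine ⟨2 * K * a₂ * (3 * π / 4) + 4 * Cr * e₀, by positivity, fun {n ω k₀ k} hk hF w => ?_⟩
  set θ₀ : ℝ := ((ω : ℝ) + 1 / 2) * sectorWidth n with hθ₀
  have htan := hbound hk hF
  rw [← hθ₀] at htan
  -- decompose `w⃗` in the frame
  have hw0 := frame_decomposition_fst hμ₁ hμ₂ θ₀ w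
  have hw1 := frame_decomposition_snd hμ₁ hμ₂ θ₀ w
  set α : ℝ := w 0 * fermiNormal μ θ₀ 0 + w 1 * fermiNormal μ θ₀ 1 with hα
  set β' : ℝ := w 0 * fermiTangent μ θ₀ 0 + w 1 * fermiTangent μ θ₀ 1 with hβ'
  have hsplit : 2 * Real.sin (k 0) * w 0 + 2 * Real.sin (k 1) * w 1 =
      α * (2 * Real.sin (k 0) * fermiNormal μ θ₀ 0 + 2 * Real.sin (k 1) * fermiNormal μ θ₀ 1) +
        β' * (2 * Real.sin (k 0) * fermiTangent μ θ₀ 0 + 2 * Real.sin (k 1) * fermiTangent μ θ₀ 1) := by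
    conv_lhs => rw [hw0, hw1]
    ring
  -- the normal pairing is bounded by `4`
  obtain ⟨hn0abs, hn1abs⟩ := abs_le_one_of_sq_add_sq (fermiNormal_normSq hμ₁ hμ₂ θ₀)
  have hnor : |2 * Real.sin (k 0) * fermiNormal μ θ₀ 0 + 2 * Real.sin (k 1) * fermiNormal μ θ₀ 1| ≤ 4 := by
    have hs0 := Real.abs_sin_le_one (k 0)
    have hs1 := Real.abs_sin_le_one (k 1)
    calc |2 * Real.sin (k 0) * fermiNormal μ θ₀ 0 + 2 * Real.sin (k 1) * fermiNormal μ θ₀ 1|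
        ≤ |2 * Real.sin (k 0) * fermiNormal μ θ₀ 0| + |2 * Real.sin (k 1) * fermiNormal μ θ₀ 1| := abs_add_le _ _
      _ = 2 * (|Real.sin (k 0)| * |fermiNormal μ θ₀ 0|) + 2 * (|Real.sin (k 1)| * |fermiNormal μ θ₀ 1|) := by
          rw [abs_mul, abs_mul, abs_mul, abs_mul, abs_two]; ring
      _ ≤ 2 * (1 * 1) + 2 * (1 * 1) := by
          gcongr
      _ = 4 := by norm_num
  -- the tangential pairing is `≤ c 2^{-n}`
  have hw : sectorWidth n = π * (2 : ℝ) ^ (-(n : ℤ)) := sectorWidth_eq_pi_mul n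
  have h42 : (4 : ℝ) ^ (-(n : ℤ)) ≤ (2 : ℝ) ^ (-(n : ℤ)) := by
    rw [four_zpow_neg_eq_sq, sq]
    exact mul_le_of_le_one_left (zpow_nonneg (by norm_num) _) (zpow_le_one_of_nonpos₀ (by norm_num) (by simp))
  have htan' : |2 * Real.sin (k 0) * fermiTangent μ θ₀ 0 + 2 * Real.sin (k 1) * fermiTangent μ θ₀ 1| ≤
      (2 * K * a₂ * (3 * π / 4) + 4 * Cr * e₀) * (2 : ℝ) ^ (-(n : ℤ)) := by
    refine htan.trans ?_
    rw [hw, add_mul]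
    refine add_le_add (le_of_eq (by ring)) ?_
    calc 4 * (Cr * (e₀ * (4 : ℝ) ^ (-(n : ℤ)))) = 4 * Cr * e₀ * (4 : ℝ) ^ (-(n : ℤ)) := by ring
      _ ≤ 4 * Cr * e₀ * (2 : ℝ) ^ (-(n : ℤ)) := mul_le_mul_of_nonneg_left h42 (by positivity)
  -- assemble
  rw [hsplit]
  calc |α * (2 * Real.sin (k 0) * fermiNormal μ θ₀ 0 + 2 * Real.sin (k 1) * fermiNormal μ θ₀ 1) +
        β' * (2 * Real.sin (k 0) * fermiTangent μ θ₀ 0 + 2 * Real.sin (k 1) * fermiTangent μ θ₀ 1)|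
      ≤ |α| * |2 * Real.sin (k 0) * fermiNormal μ θ₀ 0 + 2 * Real.sin (k 1) * fermiNormal μ θ₀ 1| +
          |β'| * |2 * Real.sin (k 0) * fermiTangent μ θ₀ 0 + 2 * Real.sin (k 1) * fermiTangent μ θ₀ 1| := by
        rw [← abs_mul, ← abs_mul]; exact abs_add_le _ _
    _ ≤ |α| * 4 + |β'| * ((2 * K * a₂ * (3 * π / 4) + 4 * Cr * e₀) * (2 : ℝ) ^ (-(n : ℤ))) :=
        add_le_add (mul_le_mul_of_nonneg_left hnor (abs_nonneg _)) (mul_le_mul_of_nonneg_left htan' (abs_nonneg _))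
    _ = 4 * |α| + (2 * K * a₂ * (3 * π / 4) + 4 * Cr * e₀) * (2 : ℝ) ^ (-(n : ℤ)) * |β'| := by ring

omit hμ₁ hμ₂ in
/-- **The denominator is `O(γ^h)` on the sector support**: `‖D(k₀, k⃗)‖ < e₀ 4^{-n}` wherever `F_{h,ω}(k₀, k⃗) ≠ 0`.
[cite: BenfattoGiulianiMastropietro2006, §2.5 (2.49)–(2.50)] -/
theorem norm_sectorDenom_lt_of_ne_zero {e₀ : ℝ} (he : 0 < e₀) {n : ℕ} {ω : ℤ} {p : ℝ × (Fin 2 → ℝ)}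
    (h : anisotropicCutoff e₀ μ n ω p ≠ 0) : ‖sectorDenom μ p‖ < e₀ * (4 : ℝ) ^ (-(n : ℤ)) := by
  rw [norm_sectorDenom]
  exact (anisotropicCutoff_ne_zero_scale he h).2

end Sector

end Literature.MathematicalPhysics.QuantumLattice
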